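import Summits.HodgeConjecture.HodgeConjecture.Theses.NoetherLefschetzOneUp
import Literature.AlgebraicGeometry.HodgeTheory.DivisorInduction
import Literature.AlgebraicGeometry.HodgeTheory.SupportedHodgeClassDescent

/-!
# Birth skeleton (BC3) of the piece `HigherVerticalClasses` — vertical classes are algebraic at every
# level `m ≥ 3`, granted all lower levels (support piece of the decomposition of `SummitGrantedFourfolds`)

Piece 3 of the crux-strategist decomposition of `SummitGrantedFourfolds` (stmt-HodgeConjecture-14600,
route `NoetherLefschetzOneUp`; line `Lines/netRegimeSplit.lean`, stub `stub_higherVerticalClasses`):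

  `HigherVerticalClasses := ∀ m ≥ 3, (∀ m' < m, Level m') → ∀ X (f : X ⟶ ℙ²), IsSmoothProjective (2m) X →
     Surjective f.base → span{rational (m,m) c vanishing off f⁻¹(T), T ⊊ ℙ² closed} ≤ algebraicClasses X m`.

A THEOREM IN PRINT, open in the tree. The printed proof has two parts, which are the two stubs:

* `stub_verticalDescent` — DESCENT OF VERTICAL CLASSES (Deligne, Hodge III Cor. 8.2.8 = the tree's
  named fact `Deligne1974_ker_restrictCompl_eq_iSup_range_complexGysin`; the semisimple lift of Hodge
  classes along Gysin morphisms, Voisin 2025 Cor. 2.12 = the named fact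
  `Voisin2025_hodgeClass_lift_complexGysin`; Hironaka, `Resolution.Hironaka1964_projective_holds`; the
  padding device of `HodgeTheory/DivisorInduction` to make the family equidimensional): a rational
  `(m,m)`-class on a smooth projective `2m`-fold `X` vanishing off `f⁻¹(T)` for a surjective
  `f : X ⟶ ℙ²` and a proper closed `T ⊊ ℙ²` is a sum of Gysin images `(g_j)_* b_j` of rational
  `(m-1,m-1)`-classes `b_j` on smooth projective `(2m-1)`-folds `Y_j → X`. In the tree this is
  `DivisorInduction.exists_equidim_family_iUnion_range_eq` + `GysinHodgeClassLift.mem_iSup_map_of_restrictCompl_eq_zero`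
  (conditional on the two named facts) once one knows that every point of `f⁻¹(T)` has codimension
  `≥ 1` (the generic point of `X` maps to the generic point of `ℙ²`, which is not in `T`).
* `stub_oddBelowMiddle` — THE HODGE CONJECTURE ONE BELOW THE MIDDLE IN ODD DIMENSION `2m-1`, GRANTED
  THE MIDDLE DEGREES OF ALL EVEN DIMENSIONS `< 2m`: in print by induction on the dimension `d ≤ 2m-1`
  — below the middle (`2p ≤ d-1`) from the `(d-1)`-folds in codimensions `p`, `p-1` by a Lefschetz
  pencil and the relative Hilbert scheme (de Cataldo–Migliorini 2009 §4 / Thomas 2005 §2: the tree's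
  THEOREM `HodgeTheory.mem_algebraicClasses_of_two_mul_le`), at the middle by the granted level, above
  the middle by hard Lefschetz (`nonempty_hardLefschetzNFold_holds` + `AlgebraicClassesCupDivisor`).
* `HigherVerticalClasses_of` (no `sorry`): Gysin images of algebraic classes are algebraic
  (`complexGysin_mem_algebraicClasses`, with the tree's theorems `gysinMap_restrictCompl_eq_zero_of_field ℂ`
  and `OrientationFamily.hasPoincareDuality`), exactly as in `divisorInduction_of_deligne_of_hodgeClassLift`.

The conclusion is the piece's statement VERBATIM (the piece is not yet a route decl: the route split is
staged, `children.json`; once it lands, replace the conclusion by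
`Summit.HodgeConjecture.HodgeConjecture.Theses.NoetherLefschetzOneUp.HigherVerticalClasses` — it unfolds to
this statement by `Iff.rfl`). `sorry` occurs only inside the two `stub_*` theorems.
-/

set_option linter.dupNamespace false

noncomputable section

namespace Summit.HodgeConjecture.HodgeConjecture.Cruxes.SummitGrantedFourfolds.HigherVerticalClassesBirth

open CategoryTheory AlgebraicGeometry
open Literature.AlgebraicGeometry Literature.AlgebraicGeometry.Motives
open Literature.AlgebraicGeometry.HodgeTheory

/-- **Stub 1 — descent of vertical classes to `(2m-1)`-folds** (print: Deligne Hodge III Cor. 8.2.8,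
Voisin 2025 Cor. 2.12, Hironaka; in the tree conditional on the named facts
`Deligne1974_ker_restrictCompl_eq_iSup_range_complexGysin` and `Voisin2025_hodgeClass_lift_complexGysin`).
[DeligneHodgeIII1974 Cor. 8.2.8; Voisin2025 Cor. 2.12, Thm. 4.4; Kollar2007 Thm. 3.27] -/
theorem stub_verticalDescent :
    ∀ (μ : Literature.AlgebraicGeometry.HodgeTheory.OrientationFamily), μ.HasPoincareDuality → ∀ ⦃m : ℕ⦄, 1 ≤ m → ∀ ⦃X : Literature.AlgebraicGeometry.Motives.SchemeOver ℂ⦄ (hX : Literature.AlgebraicGeometry.Motives.IsSmoothProjective (2 * m) X) (f : X ⟶ Literature.AlgebraicGeometry.Motives.projectiveSpace 2 ℂ), Function.Surjective f.left.base → ∀ (T : Set (Literature.AlgebraicGeometry.Motives.projectiveSpace 2 ℂ).left), IsClosed T → T ≠ Set.univ → ∀ c : Literature.AlgebraicGeometry.HodgeTheory.complexBetti X (2 * m), Literature.AlgebraicGeometry.HodgeTheory.IsRationalClass c → Literature.AlgebraicGeometry.HodgeTheory.IsOfHodgeType (2 * m) X (2 * m) m m c → Literature.AlgebraicGeometry.HodgeTheory.complexBetti.restrictCompl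 X (f.left.base ⁻¹' T) (2 * m) c = 0 → ∃ (ι : Type) (_ : Finite ι) (Y : ι → Literature.AlgebraicGeometry.Motives.SchemeOver ℂ) (hY : ∀ j, Literature.AlgebraicGeometry.Motives.IsSmoothProjective (2 * m - 1) (Y j)) (g : ∀ j, Y j ⟶ X), c ∈ ⨆ (j : ι) (d : ℕ) (hd : 2 * d + 2 * (2 * m) = 2 * m + 2 * (2 * m - 1)), (Submodule.span ℂ {b : Literature.AlgebraicGeometry.HodgeTheory.complexBetti (Y j) (2 * d) | Literature.AlgebraicGeometry.HodgeTheory.IsRationalClass b ∧ Literature.AlgebraicGeometry.HodgeTheory.IsOfHodgeType (2 * m - 1) (Y j) (2 * d) d d b}).map (Literature.AlgebraicGeometry.HodgeTheory.complexGysin μ (hY j) hX (g j) hd) := by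
  sorry

/-- **Stub 2 — the Hodge conjecture one below the middle on `(2m-1)`-folds, granted the middle
degrees of all even dimensions `< 2m`** (print: de Cataldo–Migliorini 2009 §4 Prop. 4.5 / Thomas 2005
§2 below the middle — the tree's `mem_algebraicClasses_of_two_mul_le` —, the granted levels at the
middle, hard Lefschetz above; induction on the dimension).
[DecataldoMigliorini2009 §4; Thomas2005Nodes §2; BrosnanFangNiePearlstein2009 Lemma 48] -/
theorem stub_oddBelowMiddle :
    ∀ ⦃m : ℕ⦄, 3 ≤ m → (∀ m' : ℕ, m' < m → ∀ ⦃X : Literature.AlgebraicGeometry.Motives.SchemeOver ℂ⦄, Literature.AlgebraicGeometry.Motives.IsSmoothProjective (2 * m') X → ∀ c : Literature.AlgebraicGeometry.HodgeTheory.complexBetti X (2 * m'), Literature.AlgebraicGeometry.HodgeTheory.IsRationalClass c → Literature.AlgebraicGeometry.HodgeTheory.IsOfHodgeType (2 * m') X (2 * m') m' m' c → c ∈ Literature.AlgebraicGeometry.HodgeTheory.algebraicClasses X m') → ∀ ⦃Y : Literature.AlgebraicGeometry.Motives.SchemeOver ℂ⦄, Literature.AlgebraicGeometry.Motives.IsSmoothProjective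 (2 * m - 1) Y → ∀ b : Literature.AlgebraicGeometry.HodgeTheory.complexBetti Y (2 * (m - 1)), Literature.AlgebraicGeometry.HodgeTheory.IsRationalClass b → Literature.AlgebraicGeometry.HodgeTheory.IsOfHodgeType (2 * m - 1) Y (2 * (m - 1)) (m - 1) (m - 1) b → b ∈ Literature.AlgebraicGeometry.HodgeTheory.algebraicClasses Y (m - 1) := by
  sorry

/-- **Assembly, implication form** (kernel-checked, no `sorry`): the two stubs imply the piece
`HigherVerticalClasses` (statement verbatim) — a vertical generator `c` (rational, `(m,m)`, dying
off `f⁻¹(T)`) descends by stub 1 to rational `(m-1,m-1)`-classes on `(2m-1)`-folds `Y_j → X`, which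
are algebraic by stub 2, and Gysin images of algebraic classes are algebraic
(`complexGysin_mem_algebraicClasses`, `gysinMap_restrictCompl_eq_zero_of_field ℂ`,
`OrientationFamily.hasPoincareDuality`). -/
theorem HigherVerticalClasses_of :
    (∀ (μ : Literature.AlgebraicGeometry.HodgeTheory.OrientationFamily), μ.HasPoincareDuality → ∀ ⦃m : ℕ⦄, 1 ≤ m → ∀ ⦃X : Literature.AlgebraicGeometry.Motives.SchemeOver ℂ⦄ (hX : Literature.AlgebraicGeometry.Motives.IsSmoothProjective (2 * m) X) (f : X ⟶ Literature.AlgebraicGeometry.Motives.projectiveSpace 2 ℂ), Function.Surjective f.left.base → ∀ (T : Set (Literature.AlgebraicGeometry.Motives.projectiveSpace 2 ℂ).left), IsClosed T → T ≠ Set.univ → ∀ c : Literature.AlgebraicGeometry.HodgeTheory.complexBetti X (2 * m), Literature.AlgebraicGeometry.HodgeTheory.IsRationalClass c → Literature.AlgebraicGeometry.HodgeTheory.IsOfHodgeType (2 * m) X (2 * m) m m c → Literature.AlgebraicGeometry.HodgeTheory.complexBetti.restrictCompl X (f.left.base ⁻¹' T) (2 * m) c = 0 → ∃ (ι : Type)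 (_ : Finite ι) (Y : ι → Literature.AlgebraicGeometry.Motives.SchemeOver ℂ) (hY : ∀ j, Literature.AlgebraicGeometry.Motives.IsSmoothProjective (2 * m - 1) (Y j)) (g : ∀ j, Y j ⟶ X), c ∈ ⨆ (j : ι) (d : ℕ) (hd : 2 * d + 2 * (2 * m) = 2 * m + 2 * (2 * m - 1)), (Submodule.span ℂ {b : Literature.AlgebraicGeometry.HodgeTheory.complexBetti (Y j) (2 * d) | Literature.AlgebraicGeometry.HodgeTheory.IsRationalClass b ∧ Literature.AlgebraicGeometry.HodgeTheory.IsOfHodgeType (2 * m - 1) (Y j) (2 * d) d d b}).map (Literature.AlgebraicGeometry.HodgeTheory.complexGysin μ (hY j) hX (g j) hd)) →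
    (∀ ⦃m : ℕ⦄, 3 ≤ m → (∀ m' : ℕ, m' < m → ∀ ⦃X : Literature.AlgebraicGeometry.Motives.SchemeOver ℂ⦄, Literature.AlgebraicGeometry.Motives.IsSmoothProjective (2 * m') X → ∀ c : Literature.AlgebraicGeometry.HodgeTheory.complexBetti X (2 * m'), Literature.AlgebraicGeometry.HodgeTheory.IsRationalClass c → Literature.AlgebraicGeometry.HodgeTheory.IsOfHodgeType (2 * m') X (2 * m') m' m' c → c ∈ Literature.AlgebraicGeometry.HodgeTheory.algebraicClasses X m') → ∀ ⦃Y : Literature.AlgebraicGeometry.Motives.SchemeOver ℂ⦄, Literature.AlgebraicGeometry.Motives.IsSmoothProjective (2 * m - 1) Y → ∀ b : Literature.AlgebraicGeometry.HodgeTheory.complexBetti Y (2 * (m - 1)), Literature.AlgebraicGeometry.HodgeTheory.IsRationalClass b → Literature.AlgebraicGeometry.HodgeTheory.IsOfHodgeType (2 * m - 1) Y (2 * (m - 1)) (m - 1) (m - 1) b → b ∈ Literature.AlgebraicGeometry.HodgeTheory.algebraicClasses Y (m - 1)) →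
    ∀ ⦃m : ℕ⦄, 3 ≤ m → (∀ m' : ℕ, m' < m → ∀ ⦃X : Literature.AlgebraicGeometry.Motives.SchemeOver ℂ⦄, Literature.AlgebraicGeometry.Motives.IsSmoothProjective (2 * m') X → ∀ c : Literature.AlgebraicGeometry.HodgeTheory.complexBetti X (2 * m'), Literature.AlgebraicGeometry.HodgeTheory.IsRationalClass c → Literature.AlgebraicGeometry.HodgeTheory.IsOfHodgeType (2 * m') X (2 * m') m' m' c → c ∈ Literature.AlgebraicGeometry.HodgeTheory.algebraicClasses X m') → ∀ ⦃X : Literature.AlgebraicGeometry.Motives.SchemeOver ℂ⦄ (f : X ⟶ Literature.AlgebraicGeometry.Motives.projectiveSpace 2 ℂ), Literature.AlgebraicGeometry.Motives.IsSmoothProjective (2 * m) X → Function.Surjective f.left.base → Submodule.span ℂ {c : Literature.AlgebraicGeometry.HodgeTheory.complexBetti X (2 * m) | Literature.AlgebraicGeometry.HodgeTheory.IsRationalClass c ∧ Literature.AlgebraicGeometry.HodgeTheory.IsOfHodgeType (2 * m) X (2 * m) m m c ∧ ∃ T : Set (Literature.AlgebraicGeometry.Motives.projectiveSpace 2 ℂ).left,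 IsClosed T ∧ T ≠ Set.univ ∧ Literature.AlgebraicGeometry.HodgeTheory.complexBetti.restrictCompl X (f.left.base ⁻¹' T) (2 * m) c = 0} ≤ Literature.AlgebraicGeometry.HodgeTheory.algebraicClasses X m := by
  intro hD hB m hm ih X f hX hf
  refine Submodule.span_le.mpr ?_
  rintro c ⟨hc, hpp, T, hT, hTne, h0⟩
  classical
  -- an orientation family (the complex orientations) and its Poincaré duality (a theorem)
  let μ : OrientationFamily :=
    fun _ _ h ↦ Classical.choice (Motives.ComplexPoints.isOrientableOver ℂ h)
  have hμ : μ.HasPoincareDuality := μ.hasPoincareDuality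
  -- descent of the vertical class to `(2m-1)`-folds (stub 1)
  obtain ⟨ι, hι, Y, hY, g, hmem⟩ := hD μ hμ (show 1 ≤ m by omega) hX f hf T hT hTne c hc hpp h0
  haveI := hι
  refine SetLike.le_def.mp (iSup_le fun j ↦ iSup_le fun d ↦ iSup_le fun hd ↦ ?_) hmem
  rw [Submodule.map_le_iff_le_comap, Submodule.span_le]
  rintro b ⟨hb, hb'⟩
  rw [SetLike.mem_coe, Submodule.mem_comap]
  -- `d = m - 1`: the Hodge conjecture one below the middle on the `(2m-1)`-fold `Y j` (stub 2)
  obtain rfl : d = m - 1 := by omega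
  have halg : b ∈ algebraicClasses (Y j) (m - 1) := hB hm ih (hY j) b hb hb'
  -- push forward
  exact complexGysin_mem_algebraicClasses
    (Literature.AlgebraicTopology.SingularHomology.gysinMap_restrictCompl_eq_zero_of_field ℂ) μ hμ (hY j) hX
    (g j) (by omega) hd halg

end Summit.HodgeConjecture.HodgeConjecture.Cruxes.SummitGrantedFourfolds.HigherVerticalClassesBirth

end
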